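import Literature.MathematicalPhysics.QuantumLattice.InterClusterKernelSelectionRules
import Literature.MathematicalPhysics.QuantumLattice.HubbardLiebConfig
import HarnessLib

/-!
# Spin-sector selection rule of the pair resolvent: `K(E; a, b; c, d) = 0` across `(N↑, N↓)` sectors

Topic `MathematicalPhysics/QuantumLattice`; continues `InterClusterKernelSelectionRules.lean`, which proves
the PARTICLE-NUMBER selection rule of Kato's two-body resolvent kernel `pairResolvent` (matrix
elements of the eigenprojections of an `N̂`-conserving `H` between different `N`-sectors vanish).
For Hubbard clusters the Hamiltonian conserves the two species SEPARATELY (`N↑`, `N↓`; Lieb, PRL 62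
(1989) 1201, Remark (2)(i): `H` is block diagonal in `(N↑, N↓)`, `PreservesSectors H` in the tree),
and the finer rule is what sorts the sixteen spin/process pieces of an inter-cluster kernel entry
into the vanishing ones and the ones to be certified:

* `IsInSector.mulVec_of_commute_upDown` — through the diagonal operators `diag(#up)`, `diag(#down)`
  commuting with every sector-preserving `M` (`PreservesSectors.commute_diagonal`),
  Kato's eigenprojections of a sector-preserving Hermitian `H` preserve each sector `(a, b)`
  (`IsInSector.eigenProj_mulVec`), hence `⟨a, P_s b⟩ = 0` between different `(N↑, N↓)` sectors
  (`dotProduct_eigenProj_mulVec_eq_zero_of_sector_ne`);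
* `pairResolvent_eq_zero_of_sector_ne₁₂` / `…₃₄` — `K(E; a,b; c,d) = 0` as soon as `a, b` (or `c, d`)
  lie in different `(N↑, N↓)` sectors (via the spectral-projection form `pairResolvent_eq_sum_eigenProj`).

No definition and no named fact is introduced; sorry-free.

## References

* T. Kato, *Perturbation theory for linear operators* (1966), I-§5.3 (5.26) (eigenprojections commute with
  the symmetries of the operator). [Kato1966]
* E. H. Lieb, PRL 62 (1989) 1201, Remark (2)(i). [LiebPRL1989]
* W.-F. Tsai, S. A. Kivelson, PRB 73 (2006) 214510, App. A (A1)–(A3) (intermediate states of fixed charge AND spin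
  on each cluster). [TsaiKivelson2006]
-/

noncomputable section

namespace Literature.MathematicalPhysics.QuantumLattice

open Matrix Finset

variable {Λ : Type*} [LinearOrder Λ] [Fintype Λ]

/-! ### Eigenprojections of a sector-preserving Hamiltonian preserve the `(N↑, N↓)` sectors -/

/-- A sector-preserving matrix commutes with `diag(#up)`. Lieb, PRL 62 (1989) 1201, Remark (2)(i).
[cite: LiebPRL1989, Remark (2)] -/
theorem PreservesSectors.commute_upDiagonal {M : Matrix (Finset (Orb Λ)) (Finset (Orb Λ)) ℂ}
    (hM : PreservesSectors M) :
    Commute M (Matrix.diagonal fun s : Finset (Orb Λ) => ((upPart s).card : ℂ)) :=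
  hM.commute_diagonal fun x _ => (x : ℂ)

/-- A sector-preserving matrix commutes with `diag(#down)`. Lieb, PRL 62 (1989) 1201, Remark (2)(i).
[cite: LiebPRL1989, Remark (2)] -/
theorem PreservesSectors.commute_downDiagonal {M : Matrix (Finset (Orb Λ)) (Finset (Orb Λ)) ℂ}
    (hM : PreservesSectors M) :
    Commute M (Matrix.diagonal fun s : Finset (Orb Λ) => ((downPart s).card : ℂ)) :=
  hM.commute_diagonal fun _ y => (y : ℂ)

/-- A matrix commuting with `diag(#up)` and `diag(#down)` maps each sector `(a, b)` into itself.
[folklore] -/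
theorem IsInSector.mulVec_of_commute_upDown {M : Matrix (Finset (Orb Λ)) (Finset (Orb Λ)) ℂ}
    (hu : Commute M (Matrix.diagonal fun s : Finset (Orb Λ) => ((upPart s).card : ℂ)))
    (hd : Commute M (Matrix.diagonal fun s : Finset (Orb Λ) => ((downPart s).card : ℂ)))
    {a b : ℕ} {ψ : Fock (Orb Λ)} (hψ : IsInSector a b ψ) : IsInSector a b (M *ᵥ ψ) := by
  intro s hs
  by_cases hup : (upPart s).card = a
  · -- then the down count differs
    have hdown : (downPart s).card ≠ b := fun h => hs ⟨hup, h⟩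
    refine mulVec_apply_eq_zero_of_commute_diagonal hd (c := (b : ℂ)) (fun t ht => hψ t ?_) ?_
    · exact fun h => ht (by rw [h.2])
    · exact fun h => hdown (by exact_mod_cast h)
  · refine mulVec_apply_eq_zero_of_commute_diagonal hu (c := (a : ℂ)) (fun t ht => hψ t ?_) ?_
    · exact fun h => ht (by rw [h.1])
    · exact fun h => hup (by exact_mod_cast h)

/-- **Kato's eigenprojections of a sector-preserving Hermitian `H` preserve the `(N↑, N↓)` sectors.**
[cite: Kato1966, I-§5.3 (5.26)] -/
theorem IsInSector.eigenProj_mulVec {H : Matrix (Finset (Orb Λ)) (Finset (Orb Λ)) ℂ}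
    (hP : PreservesSectors H) (s : ℝ) {a b : ℕ} {ψ : Fock (Orb Λ)} (hψ : IsInSector a b ψ) :
    IsInSector a b (eigenProj H s *ᵥ ψ) :=
  IsInSector.mulVec_of_commute_upDown
    (commute_eigenProj_of_commute hP.commute_upDiagonal.symm s)
    (commute_eigenProj_of_commute hP.commute_downDiagonal.symm s) hψ

/-- Vectors of different `(N↑, N↓)` sectors are orthogonal. [folklore] -/
theorem IsInSector.star_dotProduct_eq_zero_of_ne {a₁ b₁ a₂ b₂ : ℕ} {ψ φ : Fock (Orb Λ)}
    (hψ : IsInSector a₁ b₁ ψ) (hφ : IsInSector a₂ b₂ φ) (h : (a₁, b₁) ≠ (a₂, b₂)) : star ψ ⬝ᵥ φ = 0 := by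
  rw [dotProduct]
  refine Finset.sum_eq_zero fun s _ => ?_
  by_cases hs : (upPart s).card = a₁ ∧ (downPart s).card = b₁
  · rw [hφ s (fun h' => h (Prod.ext (hs.1.symm.trans h'.1) (hs.2.symm.trans h'.2))), mul_zero]
  · rw [Pi.star_apply, hψ s hs, star_zero, zero_mul]

/-- **Matrix elements of the eigenprojections between different `(N↑, N↓)` sectors vanish**:
`⟨a, P_s b⟩ = 0`. [cite: Kato1966, I-§5.3 (5.26)] -/
theorem dotProduct_eigenProj_mulVec_eq_zero_of_sector_ne {H : Matrix (Finset (Orb Λ)) (Finset (Orb Λ)) ℂ}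
    (hP : PreservesSectors H) (s : ℝ) {a₁ b₁ a₂ b₂ : ℕ} {a b : Fock (Orb Λ)} (ha : IsInSector a₁ b₁ a)
    (hb : IsInSector a₂ b₂ b) (hne : (a₁, b₁) ≠ (a₂, b₂)) : star a ⬝ᵥ (eigenProj H s *ᵥ b) = 0 :=
  ha.star_dotProduct_eq_zero_of_ne (hb.eigenProj_mulVec hP s) hne

/-! ### Vanishing of the pair resolvent across spin sectors -/

/-- **Wrong-spin-sector vanishing (first pair)**: for a sector-preserving Hermitian `H`, if `a` and `b` lie in
different `(N↑, N↓)` sectors then `K(E; a,b; c,d) = 0` for all `c, d`. Tsai–Kivelson 2006, App. A (A1).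
[cite: TsaiKivelson2006, App. A (A1)] -/
theorem pairResolvent_eq_zero_of_sector_ne₁₂ {H : Matrix (Finset (Orb Λ)) (Finset (Orb Λ)) ℂ}
    (hH : H.IsHermitian) (hP : PreservesSectors H) (E : ℝ) {a₁ b₁ a₂ b₂ : ℕ} {a b : Fock (Orb Λ)}
    (ha : IsInSector a₁ b₁ a) (hb : IsInSector a₂ b₂ b) (hne : (a₁, b₁) ≠ (a₂, b₂)) (c d : Fock (Orb Λ)) :
    pairResolvent hH E a b c d = 0 := by
  classical
  rw [pairResolvent_eq_sum_eigenProj]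
  refine Finset.sum_eq_zero fun s _ => Finset.sum_eq_zero fun t _ => ?_
  rw [dotProduct_eigenProj_mulVec_eq_zero_of_sector_ne hP s ha hb hne, zero_mul, zero_mul]

/-- **Wrong-spin-sector vanishing (second pair)**: if `c` and `d` lie in different `(N↑, N↓)` sectors then
`K(E; a,b; c,d) = 0` for all `a, b`. Tsai–Kivelson 2006, App. A (A1). [cite: TsaiKivelson2006, App. A (A1)] -/
theorem pairResolvent_eq_zero_of_sector_ne₃₄ {H : Matrix (Finset (Orb Λ)) (Finset (Orb Λ)) ℂ}
    (hH : H.IsHermitian) (hP : PreservesSectors H) (E : ℝ) (a b : Fock (Orb Λ)) {a₁ b₁ a₂ b₂ : ℕ}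
    {c d : Fock (Orb Λ)} (hc : IsInSector a₁ b₁ c) (hd : IsInSector a₂ b₂ d) (hne : (a₁, b₁) ≠ (a₂, b₂)) :
    pairResolvent hH E a b c d = 0 := by
  classical
  rw [pairResolvent_swap, pairResolvent_eq_zero_of_sector_ne₁₂ hH hP E hc hd hne]

/-- For Hubbard clusters: `hamiltonian G t U` preserves the sectors, so both rules apply to it.
Lieb, PRL 62 (1989) 1201, Remark (2)(i). [cite: LiebPRL1989, Remark (2)] -/
theorem pairResolvent_hamiltonian_eq_zero_of_sector_ne₁₂ (G : SimpleGraph Λ) [DecidableRel G.Adj] (t U : ℝ)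
    (E : ℝ) {a₁ b₁ a₂ b₂ : ℕ} {a b : Fock (Orb Λ)} (ha : IsInSector a₁ b₁ a) (hb : IsInSector a₂ b₂ b)
    (hne : (a₁, b₁) ≠ (a₂, b₂)) (c d : Fock (Orb Λ)) :
    pairResolvent (LiebThm1.hamiltonian_isHermitian G t U) E a b c d = 0 :=
  pairResolvent_eq_zero_of_sector_ne₁₂ _ (LiebThm1.preservesSectors_hamiltonian G t U) E ha hb hne c d

/-! ### Instance-polymorphic forms

`pairResolvent` carries a `DecidableEq (Finset (Orb Λ))` instance; the one frozen inside a definition such as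
`interClusterKernel` (reached through `LinearOrder (Orb Λ)`) is not syntactically the one instance search produces
for a concrete `Orb Λ` (through `Lex`). The following restatements take the instance as a binder, so they rewrite
under ANY instance. -/

/-- `IsInSector.eigenProj_mulVec` for an arbitrary `DecidableEq` instance on the configurations.
[cite: Kato1966, I-§5.3 (5.26)] -/
theorem IsInSector.eigenProj_mulVec' [DecidableEq (Finset (Orb Λ))] {H : Matrix (Finset (Orb Λ)) (Finset (Orb Λ)) ℂ}
    (hP : PreservesSectors H) (s : ℝ) {a b : ℕ} {ψ : Fock (Orb Λ)} (hψ : IsInSector a b ψ) :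
    IsInSector a b (eigenProj H s *ᵥ ψ) :=
  IsInSector.mulVec_of_commute_upDown
    (commute_eigenProj_of_commute hP.commute_upDiagonal.symm s)
    (commute_eigenProj_of_commute hP.commute_downDiagonal.symm s) hψ

/-- `dotProduct_eigenProj_mulVec_eq_zero_of_sector_ne` for an arbitrary `DecidableEq` instance.
[cite: Kato1966, I-§5.3 (5.26)] -/
theorem dotProduct_eigenProj_mulVec_eq_zero_of_sector_ne' [DecidableEq (Finset (Orb Λ))]
    {H : Matrix (Finset (Orb Λ)) (Finset (Orb Λ)) ℂ}
    (hP : PreservesSectors H) (s : ℝ) {a₁ b₁ a₂ b₂ : ℕ} {a b : Fock (Orb Λ)} (ha : IsInSector a₁ b₁ a)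
    (hb : IsInSector a₂ b₂ b) (hne : (a₁, b₁) ≠ (a₂, b₂)) : star a ⬝ᵥ (eigenProj H s *ᵥ b) = 0 :=
  ha.star_dotProduct_eq_zero_of_ne (hb.eigenProj_mulVec' hP s) hne

/-- `pairResolvent_eq_zero_of_sector_ne₁₂` for an arbitrary `DecidableEq` instance on the configurations.
[cite: TsaiKivelson2006, App. A (A1)] -/
theorem pairResolvent_eq_zero_of_sector_ne₁₂' [DecidableEq (Finset (Orb Λ))]
    {H : Matrix (Finset (Orb Λ)) (Finset (Orb Λ)) ℂ}
    (hH : H.IsHermitian) (hP : PreservesSectors H) (E : ℝ) {a₁ b₁ a₂ b₂ : ℕ} {a b : Fock (Orb Λ)}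
    (ha : IsInSector a₁ b₁ a) (hb : IsInSector a₂ b₂ b) (hne : (a₁, b₁) ≠ (a₂, b₂)) (c d : Fock (Orb Λ)) :
    pairResolvent hH E a b c d = 0 := by
  rw [pairResolvent_eq_sum_eigenProj]
  refine Finset.sum_eq_zero fun s _ => Finset.sum_eq_zero fun t _ => ?_
  rw [dotProduct_eigenProj_mulVec_eq_zero_of_sector_ne' hP s ha hb hne, zero_mul, zero_mul]

/-- `pairResolvent_eq_zero_of_sector_ne₃₄` for an arbitrary `DecidableEq` instance on the configurations.
[cite: TsaiKivelson2006, App. A (A1)] -/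
theorem pairResolvent_eq_zero_of_sector_ne₃₄' [DecidableEq (Finset (Orb Λ))]
    {H : Matrix (Finset (Orb Λ)) (Finset (Orb Λ)) ℂ}
    (hH : H.IsHermitian) (hP : PreservesSectors H) (E : ℝ) (a b : Fock (Orb Λ)) {a₁ b₁ a₂ b₂ : ℕ}
    {c d : Fock (Orb Λ)} (hc : IsInSector a₁ b₁ c) (hd : IsInSector a₂ b₂ d) (hne : (a₁, b₁) ≠ (a₂, b₂)) :
    pairResolvent hH E a b c d = 0 := by
  rw [pairResolvent_swap, pairResolvent_eq_zero_of_sector_ne₁₂' hH hP E hc hd hne]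

/-- Hubbard clusters, arbitrary instance. [cite: LiebPRL1989, Remark (2)] -/
theorem pairResolvent_hamiltonian_eq_zero_of_sector_ne₁₂' [DecidableEq (Finset (Orb Λ))]
    (G : SimpleGraph Λ) [DecidableRel G.Adj] (t U : ℝ)
    (E : ℝ) {a₁ b₁ a₂ b₂ : ℕ} {a b : Fock (Orb Λ)} (ha : IsInSector a₁ b₁ a) (hb : IsInSector a₂ b₂ b)
    (hne : (a₁, b₁) ≠ (a₂, b₂)) (c d : Fock (Orb Λ)) :
    pairResolvent (LiebThm1.hamiltonian_isHermitian G t U) E a b c d = 0 :=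
  pairResolvent_eq_zero_of_sector_ne₁₂' _ (LiebThm1.preservesSectors_hamiltonian G t U) E ha hb hne c d

end Literature.MathematicalPhysics.QuantumLattice
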